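import Summits.HodgeConjecture.HodgeConjecture.Theorems.NikulinTwinTransportNikulinSerreCarrierBlockCriterionLattice
import Literature.AlgebraicGeometry.Surfaces.K3HodgeTypesProofs

/-!
# Crux `NikulinSerreCarrier` · line `neron-severi-intertwiner` · stub `stub_nikulinAnchorFrame` (S1) —
# `Hom_Hdg(H²(Y), H²(X)/NS(X)) = ℚ·Ψ` from `End_Hdg(T(X)_ℚ) = ℚ`: the lattice computation

Helper file (`--supports stmt-HodgeConjecture-14464`) for the field `rigid` of the anchor `AnchorFrame`
(skeleton `Cruxes/NikulinSerreCarrier/Lines/neron-severi-intertwiner.lean`). The field asks that every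
rational type-preserving `φ : H²(Y(ℂ); ℂ) → H²(X(ℂ); ℂ)` be `c·Ψ` MODULO `NS(X)_ℂ`, `c ∈ ℚ`, for the
completed Nikulin `2`-similitude `Ψ`. The geometric input is `End_Hdg(T(X)_ℚ) = ℚ` (Zarhin; Huybrechts,
*Lectures on K3 Surfaces*, Ch. 3 Cor. 3.6, Thm. 3.7, (3.2), Rem. 3.14: `rk T(X) = 13` for the van
Geemen–Sarti surface), and THIS FILE is the linear algebra deriving the field from it, entirely on the
K3 lattice `Λ_ℂ = ℂ^{K3Index}` with its `ℚ`-structure `Λ_ℚ` (markings move it to the summit carrier in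
the sibling file `…AnchorFrameEndRigid`):

* `x, x' ∈ Λ_ℂ` are the periods of `X`, `Y` (`(x̄.x) > 0`; `x'` a projective period point with an ample
  lattice vector `u' ∈ x'^⊥`); `NS_X := {k ∈ Λ_ℚ : (k.x) = 0}`, `NS_Y := {k ∈ Λ_ℚ : (k.x') = 0}` (the
  rational `(1,1)`-classes); `M` (the similitude, `(Ma.Mb) = c(a.b)`, `c ≠ 0`) and `F` (the competitor)
  are endomorphisms of `Λ_ℂ` DEFINED OVER `ℚ` carrying `x'` into `ℂx` and `{x', x̄'}^⊥` into `{x, x̄}^⊥`.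
* HYPOTHESIS `hEnd` (= `End_Hdg(T(X)_ℚ) = ℚ` read through `ε : End_Hdg(T) ↪ ℂ`, Huybrechts Cor. 3.6): every
  endomorphism `E` of `Λ_ℂ` defined over `ℚ` with `E x ∈ ℂx` and `E({x,x̄}^⊥) ⊆ {x,x̄}^⊥` has `E x = q x`
  with `q ∈ ℚ`.
* CONCLUSION (`lattice_rigid`): some `q ∈ ℚ` has `F z − q M z ∈ NS_X ⊗ ℂ` for EVERY `z ∈ Λ_ℂ`.
  Proof: `E := F ∘ M⁻¹` satisfies `hEnd`, so `F x' = q M x'`, `F x̄' = q M x̄'`; `λ := F − qM` kills `x', x̄'`,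
  maps `NS_Y` into `NS_X`, hence `L := pr ∘ λ` (`pr` a rational projection with kernel `NS_X`) is defined
  over `ℚ` and kills `NS_Y ⊗ ℂ + ℂx' + ℂx̄'`; a rational `k` orthogonal to `ker L` is a rational
  `(1,1)`-class orthogonal to `NS_Y`, to `u'` and to itself, hence `0` (Hodge index,
  `k3Rat_eq_zero_of_period`), so `L = 0` by descent (`ratLinearMap_eq_zero_of_irreducible`, Huybrechts
  Ch. 3 Lemma 3.1): `λ(Λ_ℂ) ⊆ ker pr = NS_X ⊗ ℂ`.
No geometry and no named fact here.
-/

noncomputable section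

-- the doubled component `HodgeConjecture.HodgeConjecture` is the summit/problem layout (D-0022), not a slip
set_option linter.dupNamespace false

namespace Summit.HodgeConjecture.HodgeConjecture.Theorems.NikulinSerreCarrier.NeronSeveriIntertwiner

open scoped BigOperators
open Literature.AlgebraicGeometry.Surfaces

/-! ### `ℚ`-structure bookkeeping on `Λ_ℂ = ℂ^{K3Index}` -/

/-- A `ℂ`-linear endomorphism of `Λ_ℂ` defined over `ℚ` (it maps `Λ` into `Λ_ℚ`) maps `Λ_ℚ` into `Λ_ℚ`
(adapted from `ratEnd_ratCast` of `Theorems/NikulinTwinTransportTwinSimilitudeAlgebraicMarkings.lean`, to keep this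
file independent of the route's Theses module). [folklore] -/
theorem ratEnd_ratCast_of_intCast (ρ : Module.End ℂ (K3Index → ℂ))
    (hρ : ∀ v : K3Index → ℤ, ∃ w : K3Index → ℚ, ρ (fun i => (v i : ℂ)) = fun i => (w i : ℂ))
    (u : K3Index → ℚ) : ∃ w : K3Index → ℚ, ρ (fun i => (u i : ℂ)) = fun i => (w i : ℂ) := by
  obtain ⟨τ, hτ⟩ := exists_ratEnd_of_forall_intCast ρ hρ
  exact ⟨τ u, hτ u⟩

/-- **An endomorphism of `Λ_ℂ` defined over `ℚ` is real**: it commutes with complex conjugation of the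
coordinates (adapted from `ratEnd_star` of `Theorems/NikulinTwinTransportTwinSimilitudeAlgebraicMarkings.lean`).
[folklore] -/
theorem ratEnd_star_of_intCast (ρ : Module.End ℂ (K3Index → ℂ))
    (hρ : ∀ v : K3Index → ℤ, ∃ w : K3Index → ℚ, ρ (fun i => (v i : ℂ)) = fun i => (w i : ℂ))
    (z : K3Index → ℂ) : ρ (star z) = star (ρ z) := by
  classical
  have hreal : ∀ j : K3Index,
      star (ρ fun i => ((Pi.single j (1 : ℤ) : K3Index → ℤ) i : ℂ)) =
        ρ fun i => ((Pi.single j (1 : ℤ) : K3Index → ℤ) i : ℂ) := fun j => by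
    obtain ⟨w, hw⟩ := hρ (Pi.single j 1)
    rw [hw]
    funext i
    simp only [Pi.star_apply, _root_.star_ratCast]
  have hsz : star z = ∑ j, star (z j) • fun i => ((Pi.single j (1 : ℤ) : K3Index → ℤ) i : ℂ) := by
    conv_lhs => rw [pi_eq_sum_intSingle z]
    rw [star_sum]
    refine Finset.sum_congr rfl fun j _ => ?_
    rw [star_smul, star_intSingle]
  conv_rhs => rw [pi_eq_sum_intSingle z]
  rw [hsz, map_sum, map_sum, star_sum]
  refine Finset.sum_congr rfl fun j _ => ?_
  rw [map_smul, map_smul, star_smul, hreal]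

/-- A vector with `re (x̄.x) > 0` (a period point) is non-zero. [folklore] -/
-- adapted from `ne_zero_of_k3Form_star_self_re_pos` (Theorems/NikulinTwinTransportTwinSimilitudeAlgebraicMarkings.lean)
theorem ne_zero_of_k3Form_star_self_re_pos {x : K3Index → ℂ} (hx : 0 < (k3Form (star x) x).re) : x ≠ 0 := by
  rintro rfl
  simp [k3Form] at hx

/-- Rational matrices act compatibly with the inclusion `Λ_ℚ = ℚ²² ⊂ ℂ²² = Λ_ℂ`. [folklore] -/
theorem ratCast_map_mulVec (A : Matrix K3Index K3Index ℚ) (v : K3Index → ℚ) :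
    (A.map (Rat.cast : ℚ → ℂ)).mulVec (fun i => (v i : ℂ)) = fun i => ((A.mulVec v) i : ℂ) := by
  funext i
  simp only [Matrix.mulVec, dotProduct, Matrix.map_apply, Rat.cast_sum, Rat.cast_mul]

/-- **Complexification**: every `ℚ`-linear endomorphism `τ` of `Λ_ℚ` is the restriction of a `ℂ`-linear
endomorphism of `Λ_ℂ` (its matrix, read over `ℂ`). [folklore] -/
theorem exists_complexification (τ : Module.End ℚ (K3Index → ℚ)) :
    ∃ T : Module.End ℂ (K3Index → ℂ), ∀ u : K3Index → ℚ, T (fun i => (u i : ℂ)) = fun i => (τ u i : ℂ) := by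
  classical
  refine ⟨Matrix.toLin' ((LinearMap.toMatrix' τ).map (Rat.cast : ℚ → ℂ)), fun u => ?_⟩
  rw [Matrix.toLin'_apply, ratCast_map_mulVec]
  have h : (LinearMap.toMatrix' τ).mulVec u = τ u := by
    rw [← Matrix.toLin'_apply, Matrix.toLin'_toMatrix']
  rw [h]

/-- A rational vector of `Λ_ℂ` is real. [folklore] -/
theorem star_ratCast_pi (w : K3Index → ℚ) : star (fun i => (w i : ℂ)) = fun i => (w i : ℂ) := by
  funext i
  simp only [Pi.star_apply, _root_.star_ratCast]

/-- The K3 form of a real vector with `x̄'` is the conjugate of its form with `x'`; in particular a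
rational vector orthogonal to `x'` is orthogonal to `x̄'`. [folklore] -/
theorem k3Form_ratCast_star_eq_zero {w : K3Index → ℚ} {x : K3Index → ℂ}
    (h : k3Form (fun i => (w i : ℂ)) x = 0) : k3Form (fun i => (w i : ℂ)) (star x) = 0 := by
  have h1 := star_k3Form (fun i => (w i : ℂ)) x
  rw [star_ratCast_pi, h, star_zero] at h1
  exact h1.symm

/-- An endomorphism of `Λ_ℂ` defined over `ℚ` maps rational vectors to rational vectors, uniformly: it
restricts to a `ℚ`-linear endomorphism of `Λ_ℚ` (`exists_ratEnd_of_forall_intCast`). Recorded in the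
shape used below. [folklore] -/
theorem exists_ratForm (ρ : Module.End ℂ (K3Index → ℂ))
    (hρ : ∀ v : K3Index → ℤ, ∃ w : K3Index → ℚ, ρ (fun i => (v i : ℂ)) = fun i => (w i : ℂ)) :
    ∃ τ : Module.End ℚ (K3Index → ℚ), ∀ u : K3Index → ℚ, ρ (fun i => (u i : ℂ)) = fun i => (τ u i : ℂ) :=
  exists_ratEnd_of_forall_intCast ρ hρ

/-- **A rational projection along `NS_X = {k ∈ Λ_ℚ : (k.x) = 0}`**: a `ℚ`-linear `π` killing the rational
vectors orthogonal to `x`, with `k − π k` orthogonal to `x` for every rational `k` (the projection onto a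
complement of the subspace `NS_X ⊆ Λ_ℚ` along `NS_X`). [folklore] -/
theorem exists_ratProj (x : K3Index → ℂ) :
    ∃ π : Module.End ℚ (K3Index → ℚ),
      (∀ k : K3Index → ℚ, k3Form (fun i => (k i : ℂ)) x = 0 → π k = 0) ∧
      (∀ k : K3Index → ℚ, k3Form (fun i => ((k - π k) i : ℂ)) x = 0) := by
  -- the subspace `NS_X ⊆ Λ_ℚ` (closed under `+`, `•`; we use its span and induct)
  let S : Set (K3Index → ℚ) := {k | k3Form (fun i => (k i : ℂ)) x = 0}
  have hS : ∀ k ∈ Submodule.span ℚ S, k3Form (fun i => (k i : ℂ)) x = 0 := by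
    intro k hk
    induction hk using Submodule.span_induction with
    | mem k hk => exact hk
    | zero =>
      have h : (fun i => ((0 : K3Index → ℚ) i : ℂ)) = 0 := by funext i; simp
      rw [h, k3Form_zero_left]
    | add k l _ _ hk hl =>
      have h : (fun i => ((k + l) i : ℂ)) = (fun i => (k i : ℂ)) + fun i => (l i : ℂ) := by
        funext i; simp
      rw [h, k3Form_add_left, hk, hl, add_zero]
    | smul q k _ hk =>
      have h : (fun i => ((q • k) i : ℂ)) = (q : ℂ) • fun i => (k i : ℂ) := by
        funext i; simp
      rw [h, k3Form_smul_left, hk, mul_zero]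
  obtain ⟨W, hW⟩ := Submodule.exists_isCompl (Submodule.span ℚ S)
  refine ⟨W.projection (Submodule.span ℚ S) hW.symm, fun k hk => ?_, fun k => hS _ ?_⟩
  · have hmem : k ∈ LinearMap.ker (W.projection (Submodule.span ℚ S) hW.symm) := by
      rw [Submodule.ker_projection]
      exact Submodule.subset_span hk
    exact hmem
  · exact Submodule.sub_projection_mem hW.symm k

/-- The complex K3 form is non-degenerate on `Λ_ℂ` (`det Λ_{K3} = −1`). [cite: Huybrechts2016K3, Ch. 14 §0.3 (vi)] -/
theorem k3FormC_nondegenerate : k3FormC.Nondegenerate := by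
  refine LinearMap.BilinForm.nondegenerate_toBilin'_of_det_ne_zero' _ ?_
  have h : (k3Gram.map (Int.cast : ℤ → ℂ)).det = ((k3Gram.det : ℤ) : ℂ) := (Int.cast_det k3Gram).symm
  rw [h, k3Gram_det]
  norm_num

/-- A similitude of `(Λ_ℂ, k3Form)` of non-zero multiplier is injective. [folklore] -/
theorem injective_of_k3Form_similitude {M : Module.End ℂ (K3Index → ℂ)} {c : ℂ} (hc : c ≠ 0)
    (hM : ∀ a b, k3Form (M a) (M b) = c * k3Form a b) : Function.Injective M := by
  refine (injective_iff_map_eq_zero M).2 fun a ha => k3FormC_nondegenerate.1 a fun b => ?_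
  have h := hM a b
  rw [ha, k3Form_zero_left] at h
  rw [k3FormC_apply]
  exact (mul_eq_zero.1 h.symm).resolve_left hc

/-- **The inverse of a bijective endomorphism defined over `ℚ` is defined over `ℚ`** (its rational form
is an injective, hence bijective, endomorphism of the `22`-dimensional `Λ_ℚ`). [folklore] -/
theorem ratEnd_symm (e : (K3Index → ℂ) ≃ₗ[ℂ] (K3Index → ℂ))
    (he : ∀ v : K3Index → ℤ, ∃ w : K3Index → ℚ, e (fun i => (v i : ℂ)) = fun i => (w i : ℂ))
    (v : K3Index → ℤ) : ∃ w : K3Index → ℚ, e.symm (fun i => (v i : ℂ)) = fun i => (w i : ℂ) := by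
  obtain ⟨τ, hτ⟩ := exists_ratEnd_of_forall_intCast e.toLinearMap he
  -- `τ` is injective, hence surjective
  have hinj : Function.Injective τ := by
    refine (injective_iff_map_eq_zero τ).2 fun u hu => ?_
    have h := hτ u
    rw [hu] at h
    have h0 : (fun i => (u i : ℂ)) = 0 := by
      apply e.injective
      rw [LinearEquiv.coe_coe] at h
      rw [h, map_zero]
      funext i; simp
    funext i
    have h' := congrFun h0 i
    simp only [Pi.zero_apply, Rat.cast_eq_zero] at h'
    simpa using h'
  have hsurj : Function.Surjective τ := LinearMap.injective_iff_surjective.1 hinj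
  obtain ⟨u, hu⟩ := hsurj fun i => (v i : ℚ)
  refine ⟨u, ?_⟩
  apply e.injective
  rw [e.apply_symm_apply]
  have h := hτ u
  rw [LinearEquiv.coe_coe, hu] at h
  rw [h, intCast_eq_ratCast_intCast]

/-! ### The rigidity computation -/

/-- **`Hom_Hdg(H²(Y), H²(X)/NS(X)) = ℚ·Ψ` on the lattice.** See the module docstring: for periods `x`
(`(x̄.x) > 0`) and `x'` (projective period point with ample lattice vector `u' ∈ x'^⊥`), a similitude `M`
of non-zero multiplier and a competitor `F`, both defined over `ℚ`, carrying `x'` into `ℂx` and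
`{x', x̄'}^⊥` into `{x, x̄}^⊥`, and GRANTED `hEnd` (`End_Hdg(T(X)_ℚ) = ℚ` read through the eigenvalue on the
period: Huybrechts Ch. 3 Cor. 3.6), there is `q ∈ ℚ` with `F z − q M z ∈ NS_X ⊗ ℂ` for all `z`, where
`NS_X ⊗ ℂ` is the complex span of the rational vectors orthogonal to `x`.
[cite: Huybrechts2016K3, Ch. 3 Lemma 3.1, Cor. 3.6 and §3.3] -/
theorem lattice_rigid {x x' : K3Index → ℂ} (hxpos : 0 < (k3Form (star x) x).re)
    (hx'x' : k3Form x' x' = 0) (hx'pos : 0 < (k3Form (star x') x').re)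
    {u' : K3Index → ℤ} (hu'x' : k3Form (fun i => (u' i : ℂ)) x' = 0)
    (hu'u' : 0 < ∑ i, ∑ j, u' i * k3Gram i j * u' j)
    (M F : Module.End ℂ (K3Index → ℂ))
    (hMrat : ∀ v : K3Index → ℤ, ∃ w : K3Index → ℚ, M (fun i => (v i : ℂ)) = fun i => (w i : ℂ))
    (hFrat : ∀ v : K3Index → ℤ, ∃ w : K3Index → ℚ, F (fun i => (v i : ℂ)) = fun i => (w i : ℂ))
    {c : ℂ} (hc : c ≠ 0) (hM : ∀ a b, k3Form (M a) (M b) = c * k3Form a b)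
    (hMx : ∃ t : ℂ, M x' = t • x) (hFx : ∃ s : ℂ, F x' = s • x)
    (hF11 : ∀ v, k3Form v x' = 0 → k3Form v (star x') = 0 →
      k3Form (F v) x = 0 ∧ k3Form (F v) (star x) = 0)
    (hEnd : ∀ E : Module.End ℂ (K3Index → ℂ),
      (∀ v : K3Index → ℤ, ∃ w : K3Index → ℚ, E (fun i => (v i : ℂ)) = fun i => (w i : ℂ)) →
      (∃ s : ℂ, E x = s • x) →
      (∀ v, k3Form v x = 0 → k3Form v (star x) = 0 →
        k3Form (E v) x = 0 ∧ k3Form (E v) (star x) = 0) →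
        ∃ q : ℚ, E x = (q : ℂ) • x) :
    ∃ q : ℚ, ∀ z, F z - (q : ℂ) • M z ∈ Submodule.span ℂ
      {v : K3Index → ℂ | ∃ k : K3Index → ℚ, k3Form (fun i => (k i : ℂ)) x = 0 ∧ v = fun i => (k i : ℂ)} := by
  classical
  obtain ⟨t, ht⟩ := hMx
  obtain ⟨s, hs⟩ := hFx
  have hx0 : x ≠ 0 := ne_zero_of_k3Form_star_self_re_pos hxpos
  have hx'0 : x' ≠ 0 := ne_zero_of_k3Form_star_self_re_pos hx'pos
  -- `M` is bijective; `t ≠ 0`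
  have hMinj : Function.Injective M := injective_of_k3Form_similitude hc hM
  have ht0 : t ≠ 0 := by
    rintro rfl
    rw [zero_smul] at ht
    exact hx'0 (hMinj (by rw [ht, map_zero]))
  set e : (K3Index → ℂ) ≃ₗ[ℂ] (K3Index → ℂ) :=
    LinearEquiv.ofBijective M ⟨hMinj, LinearMap.injective_iff_surjective.1 hMinj⟩ with he
  have heM : ∀ v, e v = M v := fun v => rfl
  have hMe : ∀ v, M (e.symm v) = v := fun v => by rw [← heM, e.apply_symm_apply]
  -- reality of `M`, `F`
  have hMstar : ∀ z, M (star z) = star (M z) := ratEnd_star_of_intCast M hMrat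
  have hFstar : ∀ z, F (star z) = star (F z) := ratEnd_star_of_intCast F hFrat
  have hMx' : M (star x') = star t • star x := by rw [hMstar, ht, star_smul]
  -- `M` carries `{x', x̄'}^⊥` into `{x, x̄}^⊥`
  have hxM : x = t⁻¹ • M x' := by rw [ht, smul_smul, inv_mul_cancel₀ ht0, one_smul]
  have hxM' : star x = (star t)⁻¹ • M (star x') := by
    rw [hMx', smul_smul, inv_mul_cancel₀ (star_ne_zero.2 ht0), one_smul]
  have hM11 : ∀ v, k3Form v x' = 0 → k3Form v (star x') = 0 →
      k3Form (M v) x = 0 ∧ k3Form (M v) (star x) = 0 := fun v h1 h2 =>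
    ⟨by rw [hxM, k3Form_smul_right, hM, h1, mul_zero, mul_zero],
     by rw [hxM', k3Form_smul_right, hM, h2, mul_zero, mul_zero]⟩
  -- the endomorphism `E := F ∘ M⁻¹`
  set E : Module.End ℂ (K3Index → ℂ) := F ∘ₗ e.symm.toLinearMap with hEdef
  have hEapp : ∀ v, E v = F (e.symm v) := fun v => rfl
  have hErat : ∀ v : K3Index → ℤ, ∃ w : K3Index → ℚ, E (fun i => (v i : ℂ)) = fun i => (w i : ℂ) := by
    intro v
    obtain ⟨w, hw⟩ := ratEnd_symm e (fun v => by rw [heM]; exact hMrat v) v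
    obtain ⟨w', hw'⟩ := ratEnd_ratCast_of_intCast F hFrat w
    exact ⟨w', by rw [hEapp, hw, hw']⟩
  have hesx : e.symm x = t⁻¹ • x' := by
    apply e.injective
    rw [e.apply_symm_apply, map_smul, heM, ht, smul_smul, inv_mul_cancel₀ ht0, one_smul]
  have hEx : E x = (t⁻¹ * s) • x := by rw [hEapp, hesx, map_smul, hs, smul_smul]
  have hE11 : ∀ v, k3Form v x = 0 → k3Form v (star x) = 0 →
      k3Form (E v) x = 0 ∧ k3Form (E v) (star x) = 0 := by
    intro v h1 h2
    rw [hEapp]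
    refine hF11 _ ?_ ?_
    · -- `(M⁻¹v . x') = c⁻¹ t⁻¹ … (v . M x')`-type computation: `c (w.x') = (Mw . Mx') = (v . t x)`
      have h := hM (e.symm v) x'
      rw [hMe, ht, k3Form_smul_right, h1, mul_zero] at h
      exact (mul_eq_zero.1 h.symm).resolve_left hc
    · have h := hM (e.symm v) (star x')
      rw [hMe, hMx', k3Form_smul_right, h2, mul_zero] at h
      exact (mul_eq_zero.1 h.symm).resolve_left hc
  -- the rational eigenvalue
  obtain ⟨q, hq⟩ := hEnd E hErat ⟨_, hEx⟩ hE11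
  have hsq : s = (q : ℂ) * t := by
    have h1 : (t⁻¹ * s) • x = (q : ℂ) • x := by rw [← hEx, hq]
    have h2 : t⁻¹ * s = q := smul_left_injective ℂ hx0 h1
    rw [← h2, mul_assoc, mul_comm s t, ← mul_assoc, inv_mul_cancel₀ ht0, one_mul]
  -- `λ := F − q M` kills `x'` and `x̄'`
  have hlamx' : F x' - (q : ℂ) • M x' = 0 := by rw [hs, ht, hsq, smul_smul, sub_self]
  have hlamx'bar : F (star x') - (q : ℂ) • M (star x') = 0 := by
    rw [hFstar, hMstar, sub_eq_zero.1 hlamx', star_smul, _root_.star_ratCast, sub_self]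
  -- the rational forms of `F`, `M` and the rational projection with kernel `NS_X`
  obtain ⟨τF, hτF⟩ := exists_ratForm F hFrat
  obtain ⟨τM, hτM⟩ := exists_ratForm M hMrat
  obtain ⟨π, hπker, hπsub⟩ := exists_ratProj x
  obtain ⟨P, hP⟩ := exists_complexification π
  -- `λ` restricted to `Λ_ℚ`
  have hlamrat : ∀ u : K3Index → ℚ, F (fun i => (u i : ℂ)) - (q : ℂ) • M (fun i => (u i : ℂ)) =
      fun i => ((τF u - q • τM u) i : ℂ) := by
    intro u
    rw [hτF, hτM]
    funext i
    simp
  -- `λ` maps `NS_Y` into `NS_X`: for rational `n ⊥ x'`, `λ n` is rational and `⊥ x`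
  have hlamNS : ∀ n : K3Index → ℚ, k3Form (fun i => (n i : ℂ)) x' = 0 →
      π (τF n - q • τM n) = 0 := by
    intro n hn
    refine hπker _ ?_
    rw [← hlamrat]
    have hn' := k3Form_ratCast_star_eq_zero hn
    have h1 := (hF11 _ hn hn').1
    have h2 := (hM11 _ hn hn').1
    have hsub : F (fun i => (n i : ℂ)) - (q : ℂ) • M (fun i => (n i : ℂ)) =
        F (fun i => (n i : ℂ)) + (-(q : ℂ)) • M (fun i => (n i : ℂ)) := by
      rw [neg_smul, sub_eq_add_neg]
    rw [hsub, k3Form_add_left, k3Form_smul_left, h1, h2, mul_zero, add_zero]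
  -- `L := P ∘ λ` is defined over `ℚ` and vanishes (descent)
  set L : Module.End ℂ (K3Index → ℂ) := P ∘ₗ (F - (q : ℂ) • M) with hLdef
  have hLapp : ∀ z, L z = P (F z - (q : ℂ) • M z) := fun z => rfl
  have hL : ∀ u : K3Index → ℚ, L (fun i => (u i : ℂ)) = fun i => ((π ∘ₗ (τF - q • τM)) u i : ℂ) := by
    intro u
    rw [hLapp, hlamrat, hP]
    rfl
  have hLx' : L x' = 0 := by rw [hLapp, hlamx', map_zero]
  have hLx'bar : L (star x') = 0 := by rw [hLapp, hlamx'bar, map_zero]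
  have hLNS : ∀ n : K3Index → ℚ, k3Form (fun i => (n i : ℂ)) x' = 0 → L (fun i => (n i : ℂ)) = 0 := by
    intro n hn
    rw [hLapp, hlamrat, hP, hlamNS n hn]
    funext i; simp
  have hirr : ∀ k : K3Index → ℚ, (∀ z, L z = 0 → k3FormC (fun i => (k i : ℂ)) z = 0) → k = 0 := by
    intro k hk
    have hkx' : k3Form (fun i => (k i : ℂ)) x' = 0 := by simpa using hk x' hLx'
    have hkk : k3FormRat k k = 0 := by
      apply Rat.cast_injective (α := ℂ)
      rw [← k3Form_ratCast, Rat.cast_zero, ← k3FormC_apply]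
      exact hk _ (hLNS k hkx')
    have hku : k3FormRat k (fun i => (u' i : ℚ)) = 0 := by
      apply Rat.cast_injective (α := ℂ)
      rw [← k3Form_ratCast, Rat.cast_zero, ← k3FormC_apply, ← intCast_eq_ratCast_intCast]
      refine hk _ (by
        have h := hLNS (fun i => (u' i : ℚ)) (by rw [← intCast_eq_ratCast_intCast]; exact hu'x')
        rwa [← intCast_eq_ratCast_intCast] at h)
    exact k3Rat_eq_zero_of_period hx'x' hx'pos hu'x' hu'u' hkx' hku hkk
  have hL0 : L = 0 :=
    ratLinearMap_eq_zero_of_irreducible k3FormRat k3FormRat_nondegenerate k3FormC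
      (fun u v => by rw [k3FormC_apply, k3Form_ratCast]) (π ∘ₗ (τF - q • τM)) L hL hirr
  -- every `w − P w` lies in `NS_X ⊗ ℂ`
  have hsubP : ∀ w : K3Index → ℂ, w - P w ∈ Submodule.span ℂ
      {v : K3Index → ℂ | ∃ k : K3Index → ℚ, k3Form (fun i => (k i : ℂ)) x = 0 ∧ v = fun i => (k i : ℂ)} := by
    intro w
    rw [pi_eq_sum_intSingle w, map_sum, ← Finset.sum_sub_distrib]
    refine Submodule.sum_mem _ fun j _ => ?_
    rw [map_smul, ← smul_sub]
    refine Submodule.smul_mem _ _ (Submodule.subset_span ?_)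
    refine ⟨(fun i => ((Pi.single j (1 : ℤ) : K3Index → ℤ) i : ℚ)) -
      π (fun i => ((Pi.single j (1 : ℤ) : K3Index → ℤ) i : ℚ)), hπsub _, ?_⟩
    rw [intCast_eq_ratCast_intCast, hP]
    funext i
    simp
  refine ⟨q, fun z => ?_⟩
  have hz : F z - (q : ℂ) • M z = (F z - (q : ℂ) • M z) - P (F z - (q : ℂ) • M z) := by
    have h := LinearMap.congr_fun hL0 z
    rw [hLapp, LinearMap.zero_apply] at h
    rw [h, sub_zero]
  rw [hz]
  exact hsubP _

/-- **Registered stub `stub_anchorLatticeRigid`** (crux item stmt-HodgeConjecture-14464, line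
`neron-severi-intertwiner`, sub-goal of `stub_nikulinAnchorFrame`, field `AnchorFrame.rigid`): the lattice form
of `Hom_Hdg(H²(Y), H²(X)/NS(X)) = ℚ·Ψ` from `End_Hdg(T(X)_ℚ) = ℚ` — verbatim `lattice_rigid`, with the registered
one-line signature (fully qualified names). [cite: Huybrechts2016K3, Ch. 3 Lemma 3.1 and Cor. 3.6] -/
theorem stub_anchorLatticeRigid : ∀ {x x' : Literature.AlgebraicGeometry.Surfaces.K3Index → ℂ} (hxpos : 0 < (Literature.AlgebraicGeometry.Surfaces.k3Form (star x) x).re) (hx'x' : Literature.AlgebraicGeometry.Surfaces.k3Form x' x' = 0) (hx'pos : 0 < (Literature.AlgebraicGeometry.Surfaces.k3Form (star x') x').re) {u' : Literature.AlgebraicGeometry.Surfaces.K3Index → ℤ} (hu'x' : Literature.AlgebraicGeometry.Surfaces.k3Form (fun i => (u' i : ℂ)) x' = 0) (hu'u' : 0 < ∑ i, ∑ j, u' i * Literature.AlgebraicGeometry.Surfaces.k3Gram i j * u' j) (M F : Module.End ℂ (Literature.AlgebraicGeometry.Surfaces.K3Index → ℂ)) (hMrat : ∀ v : Literature.AlgebraicGeometry.Surfaces.K3Index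 → ℤ, ∃ w : Literature.AlgebraicGeometry.Surfaces.K3Index → ℚ, M (fun i => (v i : ℂ)) = fun i => (w i : ℂ)) (hFrat : ∀ v : Literature.AlgebraicGeometry.Surfaces.K3Index → ℤ, ∃ w : Literature.AlgebraicGeometry.Surfaces.K3Index → ℚ, F (fun i => (v i : ℂ)) = fun i => (w i : ℂ)) {c : ℂ} (hc : c ≠ 0) (hM : ∀ a b, Literature.AlgebraicGeometry.Surfaces.k3Form (M a) (M b) = c * Literature.AlgebraicGeometry.Surfaces.k3Form a b) (hMx : ∃ t : ℂ, M x' = t • x) (hFx : ∃ s : ℂ, F x' = s • x) (hF11 : ∀ v, Literature.AlgebraicGeometry.Surfaces.k3Form v x' = 0 → Literature.AlgebraicGeometry.Surfaces.k3Form v (star x') = 0 → Literature.AlgebraicGeometry.Surfaces.k3Form (F v) x = 0 ∧ Literature.AlgebraicGeometry.Surfaces.k3Form (F v) (star x) = 0) (hEnd : ∀ E : Module.End ℂ (Literature.AlgebraicGeometry.Surfaces.K3Index → ℂ), (∀ v : Literature.AlgebraicGeometry.Surfaces.K3Index → ℤ, ∃ w : Literature.AlgebraicGeometry.Surfaces.K3Index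 → ℚ, E (fun i => (v i : ℂ)) = fun i => (w i : ℂ)) → (∃ s : ℂ, E x = s • x) → (∀ v, Literature.AlgebraicGeometry.Surfaces.k3Form v x = 0 → Literature.AlgebraicGeometry.Surfaces.k3Form v (star x) = 0 → Literature.AlgebraicGeometry.Surfaces.k3Form (E v) x = 0 ∧ Literature.AlgebraicGeometry.Surfaces.k3Form (E v) (star x) = 0) → ∃ q : ℚ, E x = (q : ℂ) • x), ∃ q : ℚ, ∀ z, F z - (q : ℂ) • M z ∈ Submodule.span ℂ {v : Literature.AlgebraicGeometry.Surfaces.K3Index → ℂ | ∃ k : Literature.AlgebraicGeometry.Surfaces.K3Index → ℚ, Literature.AlgebraicGeometry.Surfaces.k3Form (fun i => (k i : ℂ)) x = 0 ∧ v = fun i => (k i : ℂ)} :=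
  fun hxpos hx'x' hx'pos _ hu'x' hu'u' M F hMrat hFrat _ hc hM hMx hFx hF11 hEnd ↦
    lattice_rigid hxpos hx'x' hx'pos hu'x' hu'u' M F hMrat hFrat hc hM hMx hFx hF11 hEnd

end Summit.HodgeConjecture.HodgeConjecture.Theorems.NikulinSerreCarrier.NeronSeveriIntertwiner

end
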